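import Summits.QuantumFields.BalabanUV.Beta.MultiscaleAveragingPointwise

/-!
# Beta / MultiscaleAveragingKernel — THE AVERAGING OPERATOR `Σ_l a_lG_lᵀG_l` OF THE MULTI-REGION MODEL OPERATOR ON THE ONE WEIGHTED CELL
# THROUGH A SITE, AS AN EXPLICIT KERNEL, AND ITS COMMUTATOR WITH A SCALAR MULTIPLICATION `[M_h, Q]` (MODEL; first file of brick (c) of the
# (w4-d)-flat programme, claim «WRS-PARAMETRIX-FLAT» journal l.25540; unit `b2b-balaban-beta-d4-p2`, GEN 12, MODEL crew)

WHAT IS CERTIFIED (kernel, 0 sorry), in the setting of the owner's `MultiscaleAveragingPointwise` (disjoint covering cube family, block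
weights `ω_l(corner_l ·)` supported on the level-`l` cells (`hsupp`), column-orthonormal transports `T`):
* `weight_eq_zero_of_ne` (only the level of the cell through `x` carries a weight at `x`), `tblk_eq_zc`;
* **`levelSum_apply_cell`**: for `x` in cell `k` (level `l`, corner `β`),
  `(QF)(x,i) = a_l·ω_l(β)²·Σ_{y ∈ cell} Σ_j (Σ_{i′} T_l(x)_{i′i}T_l(y)_{i′j})·F(y,j)`;
* **`comm_apply_cell`**: `h(x)(QF)(x,i) − (Q(hF))(x,i) = a_l·ω_l(β)²·Σ_{y ∈ cell} Σ_j τ(x,y)_{ij}·(h(x) − h(y))·F(y,j)` — the averaging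
  commutator of [B9] (3.88) sees exactly the CELL OSCILLATION of `h`;
* `abs_transport_coeff_le_one`: `|τ(x,y)_{ij}| ≤ 1` (Cauchy–Schwarz on unit columns).
Consumers: `MultiscaleRemainderWRSRows.row_comm_le` (the commutator row bound) and `MultiscaleRemainderWRS` (brick (c)).

HONEST FRAMING: discharging `BetaPertH` makes Bałaban's UV stability UNCONDITIONAL — NOT the continuum limit, NOT the
Clay problem.  HONEST DEPENDENCY (verbatim): «continuum YM on T⁴ ⇐ BetaPertH ∧ nine spine estimates (0/9 proved);
BetaPertH ⇐ (D1) ∧ (D4) ∧ CAP+tail; G-an2-4 gates asym, D1 and NE2/3/4.»  THIS MODULE DISCHARGES NOTHING of `BetaPertH`,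
asserts NOTHING printed and cites nothing as a fact (ABSOLUTE RULE): [folklore] finite-dimensional bookkeeping about the pv21 component
MODEL; members, bump data and margins are DATA (hypotheses displayed in the signatures).  LOCI (shape only): [B9] =
`Balaban1985BackgroundPropagators` (3.16)/(3.19)/(3.24) pp. 393–394, (3.87)–(3.89) pp. 408–409; [B6] = `Balaban1984PropagatorsII`
(2.38)–(2.40) pp. 229–230; [II] = `Balaban1988RG2Cluster` (2.16) p. 15.  No class change on row D4 (critical-path width 0; D4 DISCHARGE
NO DATE); NOT BetaPertH, NOT continuum, NOT Clay, NOT summit progress.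
-/

open scoped BigOperators
open Finset

namespace Summit.QuantumFields.BalabanUV.Beta.MultiscaleAveragingKernel

open Summit.QuantumFields.BalabanUV.Beta.BoxPoincare (Box)
open Summit.QuantumFields.BalabanUV.Beta.MultiscaleCoerciveTorus
open Summit.QuantumFields.BalabanUV.Beta.MultiscaleDecayBudget
open Summit.QuantumFields.BalabanUV.Beta.MultiscaleAveragingPointwise (abs_sum_col_mul_le block_filter_eq_cell)
open Literature.MathematicalPhysics.QuantumFieldTheory.Balaban1983to89
open Literature.MathematicalPhysics.QuantumFieldTheory.Balaban1983to89.B9Thm37Sum (mulOp mulOp_apply)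
open Literature.MathematicalPhysics.QuantumFieldTheory.Balaban1983to89.B9Thm37GluePU (bsrc btgt bsrc_apply btgt_apply)
open Literature.MathematicalPhysics.QuantumFieldTheory.Balaban1983to89.B9Thm37GlueTorusCov (tblk)
open Literature.MathematicalPhysics.QuantumFieldTheory.Balaban1983to89.B9Thm37GlueTorusCovComp (gMean gMean_apply gMeanT
  gMeanT_apply)
open Literature.MathematicalPhysics.QuantumFieldTheory.Balaban1983to89.B9Thm37GlueTorusCovLevels (levelOp levelSum levelSum_apply)
open B5TorusCover (UT Ctr ctrU)

noncomputable section

variable {d : ℕ} {N : Fin d → ℕ} [∀ i, NeZero (N i)] [NeZero d] {Cp J K : Type} [Fintype Cp] [DecidableEq Cp]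
  [Fintype J] [Fintype K] [DecidableEq K] (S : J → ℕ) (hS : ∀ l, 1 ≤ S l) (hdivS : ∀ l i, S l ∣ N i) (lvl : K → J)
  (zc : (k : K) → Ctr N (S (lvl k)))
  (hdisj : ∀ k k' v v', cellPt S hS hdivS lvl zc k v = cellPt S hS hdivS lvl zc k' v' → k = k')
  (hcover : ∀ x : UT N, ∃ k, ∃ v : Box d (S (lvl k)), cellPt S hS hdivS lvl zc k v = x)
  (T : J → UT N → Cp → Cp → ℝ) (a : J → ℝ) (ω : J → UT N → ℝ)

include hdisj

/-! ## §1 The averaging operator on the cell through a site: an explicit kernel and the commutator with `M_h` -/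

section Kernel

omit [NeZero d] [Fintype Cp] [DecidableEq Cp] [Fintype J] [Fintype K] [DecidableEq K] in
/-- Only the level of the cell through `x` carries a weight at `x` (disjointness + `hsupp`). [folklore] -/
theorem weight_eq_zero_of_ne
    (hsupp : ∀ l x, ω l (ctrU N (S l) (tblk (hS l) (hdivS l) x)) ≠ 0 → ∃ k v, lvl k = l ∧ cellPt S hS hdivS lvl zc k v = x)
    (x : UT N) (l : J) (hl : l ≠ lvl (cellOf S hS hdivS lvl zc hcover x)) :
    ω l (ctrU N (S l) (tblk (hS l) (hdivS l) x)) = 0 := by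
  by_contra hne
  obtain ⟨k₁, v₁, hk₁, hx₁⟩ := hsupp l x hne
  have hk : cellOf S hS hdivS lvl zc hcover x = k₁ := by
    rw [← hx₁]; exact cellOf_cellPt S hS hdivS lvl zc hdisj hcover k₁ v₁
  exact hl (by rw [hk, hk₁])

omit [NeZero d] [Fintype Cp] [DecidableEq Cp] [Fintype J] [Fintype K] in
/-- `x` lies in the block cornered at the corner of its cell. [folklore] -/
theorem tblk_eq_zc (x : UT N) (k : K) (hk : cellOf S hS hdivS lvl zc hcover x = k) :
    tblk (hS (lvl k)) (hdivS (lvl k)) x = zc k := by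
  classical
  have hmem : x ∈ univ.filter (fun x' : UT N => cellOf S hS hdivS lvl zc hcover x' = k) := mem_filter.mpr ⟨mem_univ _, hk⟩
  rw [← block_filter_eq_cell S hS hdivS lvl zc hdisj hcover k] at hmem
  exact ctrU_injective (hS (lvl k)) (mem_filter.mp hmem).2

omit [NeZero d] [DecidableEq Cp] [Fintype K] [DecidableEq K] in
/-- **THE AVERAGING OPERATOR ON THE CELL THROUGH `x`, EXPLICITLY**: for `x` in cell `k` (level `l`, corner `β`),
`((Σ_{l′} a_{l′}G_{l′}ᵀG_{l′}) F)(x,i) = a_l·ω_l(β)²·Σ_{y : corner_l y = β} Σ_j (Σ_{i′} T_l(x)_{i′i}T_l(y)_{i′j})·F(y,j)`.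
[cite: Balaban1985BackgroundPropagators, (3.16) p.393 + (3.19) p.393] [folklore] -/
theorem levelSum_apply_cell
    (hsupp : ∀ l x, ω l (ctrU N (S l) (tblk (hS l) (hdivS l) x)) ≠ 0 → ∃ k v, lvl k = l ∧ cellPt S hS hdivS lvl zc k v = x)
    (F : UT N × Cp → ℝ) (x : UT N) (i : Cp) (k : K) (hk : cellOf S hS hdivS lvl zc hcover x = k) :
    levelSum (fun l x => ctrU N (S l) (tblk (hS l) (hdivS l) x)) (fun l x => ω l (ctrU N (S l) (tblk (hS l) (hdivS l) x))) T a
        F (x, i) =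
      a (lvl k) * ω (lvl k) (ctrU N (S (lvl k)) (zc k)) ^ 2 *
        ∑ y ∈ univ.filter (fun y : UT N => ctrU N (S (lvl k)) (tblk (hS (lvl k)) (hdivS (lvl k)) y) = ctrU N (S (lvl k)) (zc k)),
          ∑ j, (∑ i', T (lvl k) x i' i * T (lvl k) y i' j) * F (y, j) := by
  classical
  have hxz : tblk (hS (lvl k)) (hdivS (lvl k)) x = zc k := tblk_eq_zc S hS hdivS lvl zc hdisj hcover x k hk
  -- the block mean over the cell
  have hmean : ∀ i', gMean (fun x => ctrU N (S (lvl k)) (tblk (hS (lvl k)) (hdivS (lvl k)) x))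
      (fun x => ω (lvl k) (ctrU N (S (lvl k)) (tblk (hS (lvl k)) (hdivS (lvl k)) x))) (T (lvl k)) F
        (ctrU N (S (lvl k)) (tblk (hS (lvl k)) (hdivS (lvl k)) x), i') =
      ω (lvl k) (ctrU N (S (lvl k)) (zc k)) *
        ∑ y ∈ univ.filter (fun y : UT N => ctrU N (S (lvl k)) (tblk (hS (lvl k)) (hdivS (lvl k)) y) = ctrU N (S (lvl k)) (zc k)),
          ∑ j, T (lvl k) y i' j * F (y, j) := by
    intro i'
    rw [gMean_apply, Finset.mul_sum, Finset.sum_filter, hxz]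
    refine Finset.sum_congr rfl fun y _ => ?_
    try simp only
    split_ifs with h
    · rw [h]
    · rfl
  -- exchange the order of summation
  have hx : ∑ i', T (lvl k) x i' i * (ω (lvl k) (ctrU N (S (lvl k)) (zc k)) *
      ∑ y ∈ univ.filter (fun y : UT N => ctrU N (S (lvl k)) (tblk (hS (lvl k)) (hdivS (lvl k)) y) = ctrU N (S (lvl k)) (zc k)),
        ∑ j, T (lvl k) y i' j * F (y, j)) =
      ω (lvl k) (ctrU N (S (lvl k)) (zc k)) *
        ∑ y ∈ univ.filter (fun y : UT N => ctrU N (S (lvl k)) (tblk (hS (lvl k)) (hdivS (lvl k)) y) = ctrU N (S (lvl k)) (zc k)),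
          ∑ j, (∑ i', T (lvl k) x i' i * T (lvl k) y i' j) * F (y, j) := by
    calc ∑ i', T (lvl k) x i' i * (ω (lvl k) (ctrU N (S (lvl k)) (zc k)) *
          ∑ y ∈ univ.filter (fun y : UT N => ctrU N (S (lvl k)) (tblk (hS (lvl k)) (hdivS (lvl k)) y) = ctrU N (S (lvl k)) (zc k)),
            ∑ j, T (lvl k) y i' j * F (y, j))
        = ∑ i', ∑ y ∈ univ.filter (fun y : UT N =>
              ctrU N (S (lvl k)) (tblk (hS (lvl k)) (hdivS (lvl k)) y) = ctrU N (S (lvl k)) (zc k)),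
            ∑ j, ω (lvl k) (ctrU N (S (lvl k)) (zc k)) * (T (lvl k) x i' i * T (lvl k) y i' j * F (y, j)) := by
          refine Finset.sum_congr rfl fun i' _ => ?_
          rw [Finset.mul_sum, Finset.mul_sum]
          refine Finset.sum_congr rfl fun y _ => ?_
          rw [Finset.mul_sum, Finset.mul_sum]
          exact Finset.sum_congr rfl fun j _ => by ring
      _ = ∑ y ∈ univ.filter (fun y : UT N => ctrU N (S (lvl k)) (tblk (hS (lvl k)) (hdivS (lvl k)) y) = ctrU N (S (lvl k)) (zc k)),
            ∑ j, ∑ i', ω (lvl k) (ctrU N (S (lvl k)) (zc k)) * (T (lvl k) x i' i * T (lvl k) y i' j * F (y, j)) := by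
          rw [Finset.sum_comm]
          exact Finset.sum_congr rfl fun y _ => Finset.sum_comm
      _ = ω (lvl k) (ctrU N (S (lvl k)) (zc k)) *
          ∑ y ∈ univ.filter (fun y : UT N => ctrU N (S (lvl k)) (tblk (hS (lvl k)) (hdivS (lvl k)) y) = ctrU N (S (lvl k)) (zc k)),
            ∑ j, (∑ i', T (lvl k) x i' i * T (lvl k) y i' j) * F (y, j) := by
          rw [Finset.mul_sum]
          refine Finset.sum_congr rfl fun y _ => ?_
          rw [Finset.mul_sum]
          refine Finset.sum_congr rfl fun j _ => ?_
          rw [Finset.sum_mul, Finset.mul_sum]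
  rw [levelSum_apply, Finset.sum_eq_single (lvl k)]
  · rw [gMeanT_apply]
    try simp only
    have hsum : ∑ i', T (lvl k) x i' i *
        gMean (fun x => ctrU N (S (lvl k)) (tblk (hS (lvl k)) (hdivS (lvl k)) x))
          (fun x => ω (lvl k) (ctrU N (S (lvl k)) (tblk (hS (lvl k)) (hdivS (lvl k)) x))) (T (lvl k)) F
          (ctrU N (S (lvl k)) (tblk (hS (lvl k)) (hdivS (lvl k)) x), i') =
        ∑ i', T (lvl k) x i' i * (ω (lvl k) (ctrU N (S (lvl k)) (zc k)) *
          ∑ y ∈ univ.filter (fun y : UT N =>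
              ctrU N (S (lvl k)) (tblk (hS (lvl k)) (hdivS (lvl k)) y) = ctrU N (S (lvl k)) (zc k)),
            ∑ j, T (lvl k) y i' j * F (y, j)) := Finset.sum_congr rfl fun i' _ => by rw [hmean i']
    rw [hsum, hx, hxz]
    ring
  · intro l' _ hl'
    rw [gMeanT_apply]
    try simp only
    rw [weight_eq_zero_of_ne S hS hdivS lvl zc hdisj hcover ω hsupp x l' (by rw [hk]; exact hl'), zero_mul, mul_zero]
  · intro h; exact absurd (mem_univ (lvl k)) h

omit [NeZero d] [DecidableEq Cp] [Fintype K] [DecidableEq K] in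
/-- **THE AVERAGING COMMUTATOR ON THE CELL THROUGH `x`**: `h(x)·(QF)(x,i) − (Q(hF))(x,i) =
a_l·ω_l(β)²·Σ_{y ∈ cell} Σ_j τ(x,y)_{ij}·(h(x) − h(y))·F(y,j)` — the block oscillation of `h` is what the commutator sees.
[cite: Balaban1985BackgroundPropagators, (3.88) p.409; Balaban1984PropagatorsII, (2.40) p.230] [folklore] -/
theorem comm_apply_cell
    (hsupp : ∀ l x, ω l (ctrU N (S l) (tblk (hS l) (hdivS l) x)) ≠ 0 → ∃ k v, lvl k = l ∧ cellPt S hS hdivS lvl zc k v = x)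
    (h : UT N → ℝ) (F : UT N × Cp → ℝ) (x : UT N) (i : Cp) (k : K) (hk : cellOf S hS hdivS lvl zc hcover x = k) :
    h x * levelSum (fun l x => ctrU N (S l) (tblk (hS l) (hdivS l) x)) (fun l x => ω l (ctrU N (S l) (tblk (hS l) (hdivS l) x))) T a
        F (x, i) -
      levelSum (fun l x => ctrU N (S l) (tblk (hS l) (hdivS l) x)) (fun l x => ω l (ctrU N (S l) (tblk (hS l) (hdivS l) x))) T a
        (mulOp (h ∘ Prod.fst) F) (x, i) =
      a (lvl k) * ω (lvl k) (ctrU N (S (lvl k)) (zc k)) ^ 2 *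
        ∑ y ∈ univ.filter (fun y : UT N => ctrU N (S (lvl k)) (tblk (hS (lvl k)) (hdivS (lvl k)) y) = ctrU N (S (lvl k)) (zc k)),
          ∑ j, (∑ i', T (lvl k) x i' i * T (lvl k) y i' j) * ((h x - h y) * F (y, j)) := by
  rw [levelSum_apply_cell S hS hdivS lvl zc hdisj hcover T a ω hsupp F x i k hk,
    levelSum_apply_cell S hS hdivS lvl zc hdisj hcover T a ω hsupp (mulOp (h ∘ Prod.fst) F) x i k hk]
  simp only [mulOp_apply, Function.comp_apply]
  set A := a (lvl k) * ω (lvl k) (ctrU N (S (lvl k)) (zc k)) ^ 2 with hA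
  rw [mul_comm (h x) _, mul_assoc, ← mul_sub]
  congr 1
  rw [Finset.sum_mul, ← Finset.sum_sub_distrib]
  refine Finset.sum_congr rfl fun y _ => ?_
  rw [Finset.sum_mul, ← Finset.sum_sub_distrib]
  exact Finset.sum_congr rfl fun j _ => by ring

omit hdisj [∀ i, NeZero (N i)] [NeZero d] [Fintype J] [Fintype K] [DecidableEq K] in
/-- The mixed transport coefficient is at most one: `|Σ_{i′} T(x)_{i′i}T(y)_{i′j}| ≤ 1` for column-orthonormal `T` (Cauchy–Schwarz). [folklore] -/
theorem abs_transport_coeff_le_one (hT : ∀ l x i i', ∑ k, T l x k i * T l x k i' = if i = i' then (1 : ℝ) else 0)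
    (l : J) (x y : UT N) (i j : Cp) : |∑ i', T l x i' i * T l y i' j| ≤ 1 := by
  have h := abs_sum_col_mul_le (T l x) (hT l x) i (fun i' => T l y i' j)
  have hcol : ∑ i', T l y i' j ^ 2 = 1 := by
    have := hT l y j j
    rw [if_pos rfl] at this
    simpa only [sq] using this
  rw [hcol, Real.sqrt_one] at h
  exact h

omit hdisj [∀ i, NeZero (N i)] [NeZero d] [Fintype Cp] [DecidableEq Cp] [Fintype J] [Fintype K] [DecidableEq K] in
/-- Rewriting `|Σ_b 1_{π b = x}·u(b)·g(b)|` as a bound by the filtered sum of `|u|·|g|`. [folklore] -/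
theorem abs_sum_ite_mul_le (π : UT N × Fin d → UT N) (x : UT N) (u g : UT N × Fin d → ℝ) :
    |∑ b, (if π b = x then u b else 0) * g b| ≤ ∑ b ∈ univ.filter (fun b => π b = x), |u b| * |g b| := by
  classical
  calc |∑ b, (if π b = x then u b else 0) * g b| ≤ ∑ b, |(if π b = x then u b else 0) * g b| :=
        Finset.abs_sum_le_sum_abs _ _
    _ = ∑ b, (if π b = x then |u b| * |g b| else 0) := Finset.sum_congr rfl fun b _ => by
        split_ifs
        · exact abs_mul _ _
        · rw [zero_mul, abs_zero]
    _ = ∑ b ∈ univ.filter (fun b => π b = x), |u b| * |g b| := (Finset.sum_filter _ _).symm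

end Kernel

end

end Summit.QuantumFields.BalabanUV.Beta.MultiscaleAveragingKernel
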